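/-
Copyright: statement-level skeleton of a published paper (lit-balaban cell, Phase-2 proof seat p25, gen 19). No proof
claims beyond what the kernel checks below.
-/
import Literature.MathematicalPhysics.QuantumFieldTheory.BalabanImbrieJaffe1984to88.BIJ88WalkIneq312RemainderBdry

/-!
# `BalabanImbrieJaffe1984to88.BIJ88WalkIneq312RemainderBeat` — T. Bałaban, J. Imbrie, A. Jaffe, *Effective action and
cluster properties of the abelian Higgs model*, Commun. Math. Phys. **114** (1988) 257–315 [BalabanImbrieJaffe1988],
§5.14 p. 312 [PDF 56], verbatim (x2 render `lit-balaban-r16/renders/cmp114/original-p056-x2.png`): *"By performing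
sufficiently many integrations by parts, we have arranged for enough small factors to beat these large factors in the
remainder terms (at least if X_{r′} is not at the boundary of Λ₁₂^{(k)})."* — **THE BEATING CLAUSE OF THE HEAD THEOREM
IN CLOSED FORM** (p25 gen 19): the head theorem of the row, `BIJ88WalkIneq312RemainderBdry.ineq312_remainder_bdry`,
carries the clause `hbeat` quantified over the terms of the expansion (*for every no-block term and every remainder
component `X_r`: `s·Π_{j∈lab X_r, j∉bdry} B_ℓ^{|obs j|} ≤ 1`*).  Since `B_ℓ ≥ 1`, it is IMPLIED by one numeric
inequality between the currencies — `s·Π_{j∉bdry} B_ℓ^{|obs j|} ≤ 1` over ALL interior observables (`hbeat_of_global`)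
— giving the head under a closed-form clause (`ineq312_remainder_bdry_global`); and with every observable declared
near the boundary (`bdry ⊇` everything) the clause is void and the head specializes to the all-observables product of
`BIJ88WalkIneq312Remainder.ineq312_remainder` without the factor `s^{#𝒳}` (`ineq312_remainder_bdry_univ`), a
consistency check between the two inhabited forms.

statement-level skeleton of published theorems with citation tags; proofs where landed; nothing here is a claim
about the Yang–Mills mass gap

PDF held: `paper:balaban1988-cmp114-bij-abelian-higgs-effective-action` (journal page = PDF page + 256); p. 312 =
PDF 56 (x2 render re-read this session, 2026-08-23).

CITATION HEADER (lean-in-tree rule).  lit-balaban cell (HOME `run/shared/lean/pub/lit-balaban/`), Phase 2, seat p25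
gen 19; row **C2.Claim@312** of `HOME/lit-balaban-r16/ROWS-C2-part2.md` (owner r16, referee ref-5; head theorem of
record `BIJ88WalkIneq312RemainderBdry.ineq312_remainder_bdry`, USED BY NAME; this file is a MEMBER).  Nothing restated.

## What is proved (0 `sorry`, standard axioms, no new `Prop` facts; theorems only)

* `hbeat_of_global`, **`ineq312_remainder_bdry_global`**, `ineq312_remainder_bdry_univ`.
HONEST SCOPE: the closed-form clause is SUFFICIENT, not print's mechanism (print beats the interior factors component
by component with the small factors that component carries; whether one `s` beats the product over ALL interior
observables is a strong smallness requirement, stated, not derived); everything else as in the head's header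
((H1)–(H5)).  NOT summit progress; NOT continuum; NOT Clay.  Imports `BIJ88WalkIneq312RemainderBdry`; modifies nothing.
-/

noncomputable section

namespace Literature.MathematicalPhysics.QuantumFieldTheory.BalabanImbrieJaffe1984to88.BIJ88WalkIneq312RemainderBeat

open Classical MeasureTheory Matrix Finset
open scoped BigOperators
open Literature.MathematicalPhysics.QuantumFieldTheory.Balaban1983to89
open B2Eq228Conditioning (weight source)
open BIJ88PolymerRep5134 (corner)
open BIJ88PolymerRep5134Gauss (prec src)
open BIJ88SlotMomentsGauss308 (fieldLaw)
open BIJ88VertexIbp311 (vexp)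
open BIJ88WickDerivatives305 (dlist)
open BIJ88VertexComponents311 (maxArity)
open BIJ88WalkRun311 BIJ88WalkExpansion311 BIJ88WalkRemainderActivity312 BIJ88WalkIneq312Remainder
  BIJ88WalkIneq312RemainderBdry

variable {S : Type} [Fintype S] {ι : Type} [Fintype ι] {κ : Type} [LinearOrder κ] {P : Type} [Fintype P]
  {β : Type} [DecidableEq β]

/-! ## §1  The closed-form beating clause -/

omit [Fintype S] [Fintype ι] [Fintype P] in
/-- **ONE SMALL FACTOR BEATING ALL INTERIOR LARGE FACTORS IMPLIES THE PER-COMPONENT BEATING CLAUSE**: if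
`s·Π_{j∉bdry} B_ℓ^{|obs j|} ≤ 1` over all interior observables (`B_ℓ ≥ 1`, `s ≥ 0`), then every remainder component
`X_r` satisfies `s·Π_{j∈lab X_r, j∉bdry} B_ℓ^{|obs j|} ≤ 1`. [cite: BalabanImbrieJaffe1988, §5.14 p.312] -/
theorem hbeat_of_global [Fintype κ] {obs : κ → List (S → ℝ)} {Bl s : ℝ} (hBl : 1 ≤ Bl) (hs : 0 ≤ s) (bdry : Finset κ)
    (hglob : s * ∏ j ∈ univ.filter (fun j => j ∉ bdry), Bl ^ (obs j).length ≤ 1) (X : WGrp S κ ι P) :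
    s * ∏ j ∈ X.lab.filter (fun j => j ∉ bdry), Bl ^ (obs j).length ≤ 1 := by
  refine le_trans (mul_le_mul_of_nonneg_left ?_ hs) hglob
  have hsub : X.lab.filter (fun j => j ∉ bdry) ⊆ univ.filter (fun j => j ∉ bdry) :=
    Finset.filter_subset_filter _ (Finset.subset_univ _)
  rw [← Finset.prod_sdiff hsub]
  have h1 : 1 ≤ ∏ j ∈ univ.filter (fun j => j ∉ bdry) \ X.lab.filter (fun j => j ∉ bdry), Bl ^ (obs j).length :=
    Finset.prod_induction _ (fun x => 1 ≤ x) (fun a b ha hb => one_le_mul_of_one_le_of_one_le ha hb) le_rfl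
      fun j _ => one_le_pow₀ hBl
  exact le_mul_of_one_le_left (prod_nonneg fun j _ => pow_nonneg (zero_le_one.trans hBl) _) h1

/-! ## §2  The head theorem under the closed-form clause -/

variable {α I : Type} [Fintype α] [DecidableEq α] [Fintype I] [DecidableEq I]
  {blk : α → I} {Δ : Matrix α α ℝ} {ℱ : α → ℝ} {W : Finset I}

/-- **THE HEAD THEOREM `ineq312_remainder_bdry` UNDER THE CLOSED-FORM BEATING CLAUSE**
`s·Π_{j∉bdry} B_ℓ^{|obs j|} ≤ 1`, `s = max(η_χ, θ_v^M, θ_w)` (finitely many observables `κ`).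
[cite: BalabanImbrieJaffe1988, §5.14 p.312 (estimate preceding (5.14.5))] -/
theorem ineq312_remainder_bdry_global [Fintype κ] (hPD : (prec blk Δ W (corner ℝ W)).PosDef)
    {Cov : P → Matrix {x : α // blk x ∈ W} {x : α // blk x ∈ W} ℝ} {trig : P → Bool} {c : ι → ℝ}
    {legs : ι → List ({x : α // blk x ∈ W} → ℝ)} {obs : κ → List ({x : α // blk x ∈ W} → ℝ)} {M : ℕ}
    {χ : ({x : α // blk x ∈ W} → ℝ) → ℝ} {oc : κ → Finset β} {vc : ι → Finset β} {reg : P → Finset β}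
    {Dir : Set ({x : α // blk x ∈ W} → ℝ)} {B' ρ : P → ℝ} {cV : ι → ℝ} {Bl θ θv θw ηχ ρ₀ Kχ : ℝ} {Λ : Finset κ → ℝ}
    {N₀ : ℕ}
    (hθ0 : 0 < θ) (hθ1 : θ ≤ 1) (hBl : 1 ≤ Bl) (hB0 : ∀ p, 0 ≤ B' p) (hρ : ∀ p, 0 ≤ ρ p) (hcV0 : ∀ m, 0 ≤ cV m)
    (hη0 : 0 ≤ ηχ) (hη1 : ηχ ≤ 1) (hθv : 0 < θv) (hθv1 : θv ≤ 1) (hθw : 0 < θw) (hθw1 : θw ≤ 1)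
    (hB : ∀ p, ∀ u ∈ Dir, ∀ w ∈ Dir, |(Cov p *ᵥ u) ⬝ᵥ w| ≤ B' p * ρ p)
    (hBf : ∀ p, ∀ u ∈ Dir, |(Cov p *ᵥ u) ⬝ᵥ src blk ℱ W| ≤ B' p * ρ p)
    (hBz : ∀ p, ∀ u ∈ Dir, ‖Cov p *ᵥ u‖ ≤ B' p * ρ p)
    (hcV : ∀ m, |c m| ≤ cV m) (hobs : ∀ j, ∀ w ∈ obs j, w ∈ Dir) (hlegs : ∀ m, ∀ w ∈ legs m, w ∈ Dir)
    (hloc : ∀ p, trig p = false → B' p ≤ Bl ∧ reg p = ∅) (hwalk : ∀ p, trig p = true → B' p ≤ θw * θ ^ (reg p).card)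
    (hvert : ∀ m, cV m * Bl ^ (legs m).length ≤ θv * θ ^ (vc m).card) (hρ₀0 : 0 ≤ ρ₀)
    (hρ₀ : ∀ u ∈ Dir, (∑ p ∈ univ.filter (fun p => Cov p *ᵥ u ≠ 0), ρ p) ≤ ρ₀)
    (hN : ∀ p, ∀ u ∈ Dir,
      (∑ m, ((range (legs m).length).filter fun j => (Cov p *ᵥ u) ⬝ᵥ (legs m).getD j 0 ≠ 0).card) ≤ N₀)
    (hKχ : 0 ≤ Kχ) (hΛ : ∀ O, 0 ≤ Λ O)
    (hE : ∀ O : Finset κ, ∀ t ∈ expand Cov trig (src blk ℱ W) c legs obs M 0 O, t.consts = 0 →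
      |∫ φ, ((t.groups.map fun h => (h.pend : Multiset _)).sum.map fun w => φ ⬝ᵥ w).prod
          * (dlist t.dirs χ φ * vexp c legs φ) ∂(fieldLaw blk Δ ℱ W)|
        ≤ Kχ * (t.dirs.map fun z => ηχ * ‖z‖).prod * Λ O)
    (bdry : Finset κ)
    (hglob : max ηχ (max (θv ^ M) θw) * ∏ j ∈ univ.filter (fun j => j ∉ bdry), Bl ^ (obs j).length ≤ 1) :
    BIJ88Sect5StatementsPart4.Ineq312 (remSys κ β)
      (fun OX => remAt (prec blk Δ W (corner ℝ W)) Cov trig (src blk ℱ W) c legs obs M χ oc vc reg [] 0 OX.1 OX.2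
        / ∫ φ, weight (prec blk Δ W (corner ℝ W)) φ * source (src blk ℱ W) φ)
      (fun OX => Kχ * Λ OX.1 * (max 1 (ρ₀ * ((phi0 legs obs M OX.1 + N₀ : ℕ) : ℝ))) ^ phi0 legs obs M OX.1)
      (fun OX => ∏ j ∈ OX.1.filter (fun j => j ∈ bdry), Bl ^ (obs j).length)
      (fun OX => nfreeOf oc OX.2) θ 1 :=
  ineq312_remainder_bdry hPD hθ0 hθ1 hBl hB0 hρ hcV0 hη0 hη1 hθv hθv1 hθw hθw1 hB hBf hBz hcV hobs hlegs hloc hwalk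
    hvert hρ₀0 hρ₀ hN hKχ hΛ hE bdry
    (fun _ _ _ _ X _ => hbeat_of_global hBl (hη0.trans (le_max_left _ _)) bdry hglob X)

/-- **CONSISTENCY WITH THE ALL-OBSERVABLES FORM**: with every observable of the (finite) family declared near the
boundary (`bdry = univ`) the beating clause is void and the head theorem charges `Π_{j∈O} B_ℓ^{|obs j|}` — the
`obsProd` of `BIJ88WalkIneq312Remainder.ineq312_remainder`, WITHOUT its factor `s^{#𝒳}` in `cF`.
[cite: BalabanImbrieJaffe1988, §5.14 p.312 (estimate preceding (5.14.5))] -/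
theorem ineq312_remainder_bdry_univ [Fintype κ] (hPD : (prec blk Δ W (corner ℝ W)).PosDef)
    {Cov : P → Matrix {x : α // blk x ∈ W} {x : α // blk x ∈ W} ℝ} {trig : P → Bool} {c : ι → ℝ}
    {legs : ι → List ({x : α // blk x ∈ W} → ℝ)} {obs : κ → List ({x : α // blk x ∈ W} → ℝ)} {M : ℕ}
    {χ : ({x : α // blk x ∈ W} → ℝ) → ℝ} {oc : κ → Finset β} {vc : ι → Finset β} {reg : P → Finset β}
    {Dir : Set ({x : α // blk x ∈ W} → ℝ)} {B' ρ : P → ℝ} {cV : ι → ℝ} {Bl θ θv θw ηχ ρ₀ Kχ : ℝ} {Λ : Finset κ → ℝ}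
    {N₀ : ℕ}
    (hθ0 : 0 < θ) (hθ1 : θ ≤ 1) (hBl : 1 ≤ Bl) (hB0 : ∀ p, 0 ≤ B' p) (hρ : ∀ p, 0 ≤ ρ p) (hcV0 : ∀ m, 0 ≤ cV m)
    (hη0 : 0 ≤ ηχ) (hη1 : ηχ ≤ 1) (hθv : 0 < θv) (hθv1 : θv ≤ 1) (hθw : 0 < θw) (hθw1 : θw ≤ 1)
    (hB : ∀ p, ∀ u ∈ Dir, ∀ w ∈ Dir, |(Cov p *ᵥ u) ⬝ᵥ w| ≤ B' p * ρ p)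
    (hBf : ∀ p, ∀ u ∈ Dir, |(Cov p *ᵥ u) ⬝ᵥ src blk ℱ W| ≤ B' p * ρ p)
    (hBz : ∀ p, ∀ u ∈ Dir, ‖Cov p *ᵥ u‖ ≤ B' p * ρ p)
    (hcV : ∀ m, |c m| ≤ cV m) (hobs : ∀ j, ∀ w ∈ obs j, w ∈ Dir) (hlegs : ∀ m, ∀ w ∈ legs m, w ∈ Dir)
    (hloc : ∀ p, trig p = false → B' p ≤ Bl ∧ reg p = ∅) (hwalk : ∀ p, trig p = true → B' p ≤ θw * θ ^ (reg p).card)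
    (hvert : ∀ m, cV m * Bl ^ (legs m).length ≤ θv * θ ^ (vc m).card) (hρ₀0 : 0 ≤ ρ₀)
    (hρ₀ : ∀ u ∈ Dir, (∑ p ∈ univ.filter (fun p => Cov p *ᵥ u ≠ 0), ρ p) ≤ ρ₀)
    (hN : ∀ p, ∀ u ∈ Dir,
      (∑ m, ((range (legs m).length).filter fun j => (Cov p *ᵥ u) ⬝ᵥ (legs m).getD j 0 ≠ 0).card) ≤ N₀)
    (hKχ : 0 ≤ Kχ) (hΛ : ∀ O, 0 ≤ Λ O)
    (hE : ∀ O : Finset κ, ∀ t ∈ expand Cov trig (src blk ℱ W) c legs obs M 0 O, t.consts = 0 →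
      |∫ φ, ((t.groups.map fun h => (h.pend : Multiset _)).sum.map fun w => φ ⬝ᵥ w).prod
          * (dlist t.dirs χ φ * vexp c legs φ) ∂(fieldLaw blk Δ ℱ W)|
        ≤ Kχ * (t.dirs.map fun z => ηχ * ‖z‖).prod * Λ O) :
    BIJ88Sect5StatementsPart4.Ineq312 (remSys κ β)
      (fun OX => remAt (prec blk Δ W (corner ℝ W)) Cov trig (src blk ℱ W) c legs obs M χ oc vc reg [] 0 OX.1 OX.2
        / ∫ φ, weight (prec blk Δ W (corner ℝ W)) φ * source (src blk ℱ W) φ)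
      (fun OX => Kχ * Λ OX.1 * (max 1 (ρ₀ * ((phi0 legs obs M OX.1 + N₀ : ℕ) : ℝ))) ^ phi0 legs obs M OX.1)
      (fun OX => ∏ j ∈ OX.1, Bl ^ (obs j).length)
      (fun OX => nfreeOf oc OX.2) θ 1 := by
  have hs1 : max ηχ (max (θv ^ M) θw) ≤ 1 := max_le hη1 (max_le (pow_le_one₀ hθv.le hθv1) hθw1)
  have h := ineq312_remainder_bdry_global (oc := oc) (vc := vc) (reg := reg) (χ := χ) hPD hθ0 hθ1 hBl hB0 hρ hcV0
    hη0 hη1 hθv hθv1 hθw hθw1 hB hBf hBz hcV hobs hlegs hloc hwalk hvert hρ₀0 hρ₀ hN hKχ hΛ hE (univ : Finset κ)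
    (by rw [Finset.filter_false_of_mem fun j _ => not_not_intro (Finset.mem_univ j), Finset.prod_empty, mul_one]
        exact hs1)
  intro OX
  simpa only [Finset.filter_true_of_mem fun j (_ : j ∈ OX.1) => Finset.mem_univ j] using h OX

end Literature.MathematicalPhysics.QuantumFieldTheory.BalabanImbrieJaffe1984to88.BIJ88WalkIneq312RemainderBeat

end
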